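/-
  Summits/AtomisticToContinuum/Crystallization/Theorems/OverbindingBudgetAffineFarRechartShelter.lean

  residual stmt-AtomisticToContinuum-31280 · slot Z `FarAggregatePricing 12 (1/25) (1/2000) (1/(2·10⁷))` · the L leaf Z3k `SitewiseRechartLoss`
  (…FarRechartKernel, p844159) and its near-field half NF `NearFieldRechartLoss` (…FarRechartCoherence, p844337):
  THE CLEAR-RADIUS NORMAL FORM (decomp-a2c lens-4 «minimal counterexample / extremal reduction», g51).
  Imports ONLY the tree file `…OverbindingBudgetAffineFarRechartCoherence`.  0 sorry · 0 axiom · no instance · no notation · no option.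
-/
import Summits.AtomisticToContinuum.Crystallization.Theorems.OverbindingBudgetAffineFarRechartCoherence

/-! # NF ⟸ SM — the near field priced by the CLEAR RADIUS; Z3k ⟸ FF ∧ SM; slot Z from seven leaves

THESIS (g51).  Every near-field counterexample to Z3k reduces to a SHELTERED one.  Let `m·nn_i` be the distance from the normal far row `i` to the
nearest NON-GOOD site (the clear radius; `Sheltered`, tree …FarSmoothSplit v7) and `R_ε = (C₁ε₁)^{-1/2}` the drift radius.  Trichotomy, all
glue PROVED here (`nearFieldRechartLoss_of_shelteredMatching`):
* `m ≤ 2λ` — a defect within `2λ·nn_i`: the defect kernel already has the floor `K ≥ (2λ)⁻⁴` (`inv_pow_le_defectKernel_of_near`) and the whole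
  near-field class costs at most `L(δ) = 2¹⁴/(12δ⁹)` (`neg_smoothTail_le_window`): loss `≤ (2λ)⁴ L · K` with the EMPTY matching;
* `m > λR_ε` — sheltered out to the drift radius: the rigidity leaf SM matches every good site of the `R_ε`-ball, the near-field unmatched class is
  EMPTY, loss `0`;
* `2λ < m ≤ λR_ε` — SM at `R := m/(2λ)` (sheltered at `λR = m/2 < m` by MINIMALITY of `m`) matches the `R`-ball, the packing tail lemma prices the
  rest by `L/R² = 4λ²L/m²`, and the nearest defect gives `K ≥ m⁻⁴`: loss `≤ 4λ²L·m²·K ≤ 4λ⁴L/(C₁ε₁) · K` because `m² ≤ λ²R_ε² = λ²/(C₁ε₁)`.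
So `A_N := 16λ⁴L + 4λ⁴L/(C₁ε₁)` — `ε₁`-dependent, which Z3k's quantifier order (`∃ C'''` before `ε₁, δ`; `∃ A` AFTER both) permits, exactly as it
permitted g50's `A_N = L/(κC₁ε₁)`.

THE ONE NEW LEAF
* SM · `ShelteredMatching θ θ₀` [NEW · M/L · TRUE-type · ATTACKABLE now — discrete rigidity of defect-free affinely-registered close packings below
  the drift radius]: R_aff ⇒ `∀ C ≥ 0 ∃ λ ≥ 1, C₁ > 0, D ≥ 0, ε_M > 0 ∀ ε₁ ≤ ε_M ∀ δ ∀ y ∀ i ∈ Far ∖ sb ∀ c` (`IsChart C ε₁`, `ChartAdmissible θ`)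
  `∀ R ∈ [1, R_ε]`: `Sheltered (λR)` ⇒ some rechart `c'` of `c` and a fine matching `(M, π)` (`Matched D ε₁`, tolerance `Dε₁nn_i(1+s²) ∧ nn_i/4`)
  covering EVERY good site within `R·nn_i`.  Content: (COMB) in a ball all of whose sites are `AffReg(ε₁, θ)` every site is fcc- or hcp-two-shell
  framed, so by layer propagation (Hales, Dense Sphere Packings §1.3; Literature `LayerPropagation`, the `ε₁ = θ = 0` skeleton) the ball is ONE
  stack of hexagonal layers along ONE close-packed family — two families carrying stacking irregularities inside `λR` would meet on a non-good
  junction line within `≈ 1.8R` (planes at 70.5°), and an irregularity cannot end inside good matter (its rim is a partial) — i.e. one Barlow word,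
  which `Recharts` lets `c'` carry (free Hägg continuation outside the core ball, free axis among those the core allows); (RIG) neighbouring
  two-shell frames overlap in ≥ 7 sites, so the local affine maps differ by `O(ε₁)` between neighbours and the configuration deviates from the
  chart's affine image by `≤ c·ε₁·s²·nn_i` at distance `s·nn_i` (second order; the chart's own `Cε₁/9` mis-fit of `B` is first order with slope
  `≤ C/18 ≤ D`) — inside `matchTol` for `D ≥ c + C` and inside the cap `nn_i/4` because `s ≤ R ≤ R_ε` and SM chooses `C₁ ≥ 8D`.
  WHY STRICTLY WEAKER than SC `ShortRangeCoherence` (g50): SM speaks only about rows whose `λR`-ball is defect-FREE — no coherence radius, no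
  `CoarseCoherent` alternative, no defect to continue past; and than Z3k/NF: no loss functional, no kernel, no energy.  WHY IT MIGHT FAIL: only
  through the typing of `matchTol` (a first-order drift not absorbed by `c.B` — excluded: `IsChart` pins `B` to `Cε₁` on the 9-ball) or of
  `Recharts` (an axis the core allows but `Recharts` forbids — excluded: `Recharts` quantifies over all reference isometries `R` fixing the core points).

WHAT THIS DOES TO THE g50 SPLIT (appendix §5, all PROVED): `ShelteredMatching ⇒ DefectLocality ⇒ IncoherenceCost` — the rigidity leaf DOMINATES
the g50 incidence leaf IC (as typed: `κ` after `ε₁`), so the L-slot leaf list v9 `{FF, SC, IC}` contracts to v10 `{FF, SM}`; SC and IC stay in the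
tree as the finer (coherence-radius) assembly `nearFieldRechartLoss_of_coherence_cost`, now also fed by SM (`nearFieldRechartLoss_of_coherence_sheltered`).
The UNIFORM-κ reading of IC (κ before ε₁) is FALSE: an unrelaxed mis-registered Barlow BUBBLE (a translated or rotated close-packed grain of radius
≥ 13·nn with an abrupt wall, N₀ ≈ 7·10⁴ non-good sites by the depth-12 halo) at distance `2r` from the row is coarsely incoherent at `2r` with
`r³K ≈ N₀r³/(2r)⁴ ≈ 4·10³/r → 0` (`r = R_ε → ∞` as `ε₁ → 0`); the dependent κ survives it (`κ(ε₁) ≍ √(C₁ε₁)`), and DL ⇒ IC shows why: one defect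
within `λr` is all IC ever needed (answering review p844337 advisory 2 and critic row 829 (B) precision).

WHY THE g49 «clear radius is dead» VERDICT DOES NOT APPLY: it priced the matter beyond the clear radius against an `ε₁`-FREE constant (loss
`δ⁻³m⁻³` vs point-defect kernel `m⁻⁴`, ratio `∝ m` unbounded); in the near field `m ≤ λR_ε`, so the ratio is `≤ λ²/(C₁ε₁)`-type — a legal `A(ε₁, δ)`,
the same currency g50 already spent.  The price of the shortcut is honesty about `A_N ∝ (C₁ε₁)⁻¹`; an `ε₁`-free `A_N` would need the coherence
radius AND a true replacement of uniform-κ IC weighing loss against kernel jointly (the bubble is cheap in loss too) — OPTIONAL, off the critical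
path, because `FarAggregatePricing` fixes its wall constant after `ε₁, δ`.

WHY NOVEL (vs v5–v9): the first near-field normal form with NO gauge object at all — the extremal quantity is the clear radius (chart-free,
potential-free), the only chart-dependent statement left below the drift radius is a rigidity theorem on defect-free balls, and the L-slot's only
UNDECIDED content is now the chart-free far-field leaf FF.
HIDDEN-GAUGE AUDIT: the ∀-chart enters SM only through `Recharts θ c ·` (its conclusion); `Sheltered`, the kernel floor, the window lemma and the
trichotomy mention no chart.  Quantifiers: `λ, C₁, D, ε_M` before `ε₁`; `A_N` after `ε₁, δ` (used: `L(δ)`, `(C₁ε₁)⁻¹`).  Degenerate instances: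
`Far ∖ sb = ∅` ⇒ vacuous (fine); SM non-vacuous (a 1 %-sheared finite fcc block: interior rows are far, sheltered, charted); SM for `R ≤ 9` is nearly
the chart's own exactness (`c' = c`), its content is continuation to `R ∈ (9, R_ε]`.
-/

namespace Summit.AtomisticToContinuum.Crystallization.Theorems.OverbindingBudgetAffineFarSmoothSplit

open scoped BigOperators Classical
open Literature.MathematicalPhysics.StatisticalMechanics
open Literature.Geometry.DiscreteGeometry (nearestDist nearestDist_nonneg nearestDist_le_dist)
open Summit.AtomisticToContinuum.Crystallization.Theorems.OverbindingBudgetBalancedCensusStatements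
open Summit.AtomisticToContinuum.Crystallization.Theorems.OverbindingBudgetAffineLadder
open Summit.AtomisticToContinuum.Crystallization.Theorems.OverbindingBudgetAffineLocalisation

variable {N : ℕ}

/-! ## §1  The kernel floor, the window bound, and the arithmetic of the trichotomy (PROVED) -/

/-- **KF · KERNEL FLOOR (PROVED)**: one NON-GOOD site within `s·nn_i` of a good row `i` gives `defectKernel ≥ s⁻⁴` (one term of the sum). [this file] -/
theorem inv_pow_le_defectKernel_of_near {ρ₁ ε₁ θ δ : ℝ} {y : Fin N → EuclideanSpace ℝ (Fin 3)} {i k : Fin N}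
    (hi : i ∈ goodSet ρ₁ ε₁ θ δ y) (hk : k ∉ goodSet ρ₁ ε₁ θ δ y) (hδ : 0 < δ) {s : ℝ} (hs : 0 < s)
    (hd : dist (y k) (y i) ≤ s * nearestDist y i) :
    1 / s ^ 4 ≤ defectKernel ρ₁ ε₁ θ δ y i := by
  have hki : k ≠ i := fun h => hk (h ▸ hi)
  have hnn : 0 < nearestDist y i := lt_of_lt_of_le hδ (inWindow_of_mem_goodSet hi).1
  have hdpos : 0 < dist (y i) (y k) := lt_of_lt_of_le hnn (nearestDist_le_dist y hki)
  have hd' : dist (y i) (y k) ≤ s * nearestDist y i := by rw [dist_comm]; exact hd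
  have h1 : 1 / s ≤ nearestDist y i / dist (y i) (y k) := by
    have he : nearestDist y i / (s * nearestDist y i) = 1 / s := by
      field_simp
    rw [← he]
    exact div_le_div_of_nonneg_left hnn.le hdpos hd'
  have hterm : 1 / s ^ 4 ≤ (nearestDist y i / dist (y i) (y k)) ^ 4 := by
    rw [← one_div_pow]
    exact pow_le_pow_left₀ (by positivity) h1 4
  have hkmem : k ∈ (goodSet ρ₁ ε₁ θ δ y)ᶜ := Finset.mem_compl.mpr hk
  unfold defectKernel
  exact hterm.trans (Finset.single_le_sum (f := fun k => (nearestDist y i / dist (y i) (y k)) ^ 4)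
    (fun k _ => by positivity) hkmem)

/-- **WINDOW BOUND (PROVED)**: the smooth tail inflow into a good row from ANY class of good sites is `≥ −2¹⁴/(12δ⁹)` — the packing tail lemma at
radius `1` on `S ∖ {i}` (every other site is at distance `≥ nn_i`), the `i`-term vanishing because `V(0) = 0`. [this file] -/
theorem neg_smoothTail_le_window {ρ₁ ε₁ θ δ : ℝ} (hδ : 0 < δ) (hδ2 : δ ≤ 2) {y : Fin N → EuclideanSpace ℝ (Fin 3)}
    (hy : Function.Injective y) {i : Fin N} (hi : i ∈ goodSet ρ₁ ε₁ θ δ y) {S : Finset (Fin N)} (hS : S ⊆ goodSet ρ₁ ε₁ θ δ y) :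
    -smoothTail S y i ≤ 2 ^ 14 / (12 * δ ^ 9) := by
  have herase : smoothTail (S.erase i) y i = smoothTail S y i := by
    unfold smoothTail
    rw [Finset.sum_erase]
    rw [dist_self, lennardJones_zero, mul_zero]
  rw [← herase]
  have h := neg_smoothTail_le_of_radius hδ hδ2 hy hi ((Finset.erase_subset i S).trans hS) le_rfl
    (fun k hk => by rw [one_mul]; exact nearestDist_le_dist y (Finset.ne_of_mem_erase hk))
  simpa using h

/-- Arithmetic of case 1 (a defect within `2λ`): `L ≤ (16λ⁴L + 4λ⁴L/Cε)·K` from `K ≥ (2λ)⁻⁴`. [this file] -/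
theorem loss_le_of_kernelFloor_near {L lam Cε K : ℝ} (hL : 0 ≤ L) (hlam : 0 < lam) (hCε : 0 < Cε) (hK : 1 / (2 * lam) ^ 4 ≤ K) :
    L ≤ (16 * lam ^ 4 * L + 4 * lam ^ 4 * L / Cε) * K := by
  have hK0 : 0 ≤ K := le_trans (by positivity) hK
  have h1 : 1 ≤ K * (2 * lam) ^ 4 := (div_le_iff₀ (by positivity)).mp hK
  have h2 : 0 ≤ 4 * lam ^ 4 * L / Cε * K := by positivity
  calc L = L * 1 := (mul_one L).symm
    _ ≤ L * (K * (2 * lam) ^ 4) := mul_le_mul_of_nonneg_left h1 hL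
    _ = 16 * lam ^ 4 * L * K := by ring
    _ ≤ 16 * lam ^ 4 * L * K + 4 * lam ^ 4 * L / Cε * K := by linarith
    _ = (16 * lam ^ 4 * L + 4 * lam ^ 4 * L / Cε) * K := by ring

/-- Arithmetic of case 3 (nearest defect at `m ∈ (2λ, λR_ε]`): `L/(m/(2λ))² ≤ (16λ⁴L + 4λ⁴L/Cε)·K` from `K ≥ m⁻⁴` and `m² ≤ λ²/Cε`. [this file] -/
theorem loss_le_of_kernelFloor_clear {L lam Cε K m : ℝ} (hL : 0 ≤ L) (hlam : 0 < lam) (hCε : 0 < Cε) (hm : 0 < m)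
    (hK : 1 / m ^ 4 ≤ K) (hm2 : m ^ 2 ≤ lam ^ 2 * (1 / Cε)) :
    L / (m / (2 * lam)) ^ 2 ≤ (16 * lam ^ 4 * L + 4 * lam ^ 4 * L / Cε) * K := by
  have hK0 : 0 ≤ K := le_trans (by positivity) hK
  have hm0 : m ≠ 0 := hm.ne'
  have hlam0 : lam ≠ 0 := hlam.ne'
  have hCε0 : Cε ≠ 0 := hCε.ne'
  have e1 : L / (m / (2 * lam)) ^ 2 = 4 * lam ^ 2 * L * m ^ 2 * (1 / m ^ 4) := by
    field_simp
    ring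
  have h3 : 0 ≤ 16 * lam ^ 4 * L * K := by positivity
  calc L / (m / (2 * lam)) ^ 2 = 4 * lam ^ 2 * L * m ^ 2 * (1 / m ^ 4) := e1
    _ ≤ 4 * lam ^ 2 * L * m ^ 2 * K := mul_le_mul_of_nonneg_left hK (by positivity)
    _ ≤ 4 * lam ^ 2 * L * (lam ^ 2 * (1 / Cε)) * K := by
        apply mul_le_mul_of_nonneg_right _ hK0
        exact mul_le_mul_of_nonneg_left hm2 (by positivity)
    _ = 4 * lam ^ 4 * L / Cε * K := by
        field_simp
    _ ≤ 16 * lam ^ 4 * L * K + 4 * lam ^ 4 * L / Cε * K := by linarith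
    _ = (16 * lam ^ 4 * L + 4 * lam ^ 4 * L / Cε) * K := by ring

/-- Arithmetic of the domination DL ⇒ IC: `Cε/λ⁴ ≤ r³·K` from `K ≥ (λr)⁻⁴`, `Cε·r² ≤ 1`, `r ≥ 1`. [this file] -/
theorem kappa_le_of_kernelFloor {Cε lam r K : ℝ} (hr : 1 ≤ r) (hlam : 0 < lam) (hCε : 0 < Cε) (hcap : Cε * r ^ 2 ≤ 1)
    (hK : 1 / (lam * r) ^ 4 ≤ K) : Cε / lam ^ 4 ≤ r ^ 3 * K := by
  have hr0 : 0 < r := by linarith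
  have hlam0 : lam ≠ 0 := hlam.ne'
  have hr0' : r ≠ 0 := hr0.ne'
  have h1 : Cε ≤ 1 / r := by
    rw [le_div_iff₀ hr0]
    nlinarith [mul_le_mul_of_nonneg_left (show r ≤ r ^ 2 by nlinarith) hCε.le]
  calc Cε / lam ^ 4 ≤ (1 / r) / lam ^ 4 := div_le_div_of_nonneg_right h1 (by positivity)
    _ = r ^ 3 * (1 / (lam * r) ^ 4) := by
        field_simp
    _ ≤ r ^ 3 * K := mul_le_mul_of_nonneg_left hK (by positivity)

/-! ## §2  The leaf: sheltered matching (rigidity of defect-free registered close packings below the drift radius) -/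

/-- **SM · `ShelteredMatching θ θ₀`** (NEW · M/L · TRUE-type · ATTACKABLE now): R_aff ⇒ `∀ C ≥ 0 ∃ λ ≥ 1, C₁ > 0, D ≥ 0, ε_M > 0 ∀ ε₁ ≤ ε_M ∀ δ ∈ (0,2]`:
for every injective configuration, every NORMAL far row `i ∈ Far ∖ sb` with an admissible `Cε₁`-exact chart `c`, and every radius `1 ≤ R` below the
drift radius (`C₁ε₁R² ≤ 1`): if EVERY site within `λR·nn_i` of `y i` is good (`Sheltered (λR)`), then some rechart `c'` of `c` and a fine matching
`(M, π)` (`Matched D ε₁`) cover every good site within `R·nn_i`.  (COMB: one Barlow word by perturbed layer propagation — a second family of stacking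
irregularities inside `λR` would force a non-good junction line; RIG: second-order drift of overlapping two-shell frames, inside `matchTol` below `R_ε`.)
Might fail: only by the typing of `matchTol`/`Recharts` (a first-order drift not absorbed by `c.B`; an axis the core allows but `Recharts` forbids) —
both excluded on paper (`IsChart` pins `B` to `Cε₁/9`; `Recharts` ranges over all reference isometries fixing the core points). -/
def ShelteredMatching (θ θ₀ : ℝ) : Prop :=
  AffineChartStraightening → ∀ C : ℝ, 0 ≤ C → ∃ lam C₁ D εM : ℝ, 1 ≤ lam ∧ 0 < C₁ ∧ 0 ≤ D ∧ 0 < εM ∧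
    ∀ ε₁ : ℝ, 0 < ε₁ → ε₁ ≤ εM → ∀ δ : ℝ, 0 < δ → δ ≤ 2 →
      ∀ (N : ℕ) (y : Fin N → EuclideanSpace ℝ (Fin 3)), Function.Injective y →
        ∀ i ∈ farSet θ₀ 12 ε₁ θ δ y \ goodScaleBadSet 12 ε₁ θ δ y, ∀ c : Chart, IsChart C ε₁ y i c → ChartAdmissible θ c →
          ∀ R : ℝ, 1 ≤ R → C₁ * ε₁ * R ^ 2 ≤ 1 → Sheltered (lam * R) 12 ε₁ θ δ y i →
            ∃ (c' : Chart) (M : Finset (Fin N)) (π : Fin N → EuclideanSpace ℝ (Fin 3)),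
              Recharts θ c c' ∧ M ⊆ goodSet 12 ε₁ θ δ y ∧ Matched D ε₁ y i c' M π ∧
              ∀ k ∈ goodSet 12 ε₁ θ δ y, dist (y k) (y i) ≤ R * nearestDist y i → k ∈ M

/-! ## §3  The glue: the clear-radius trichotomy (PROVED) -/

/-- ★ **`ShelteredMatching ⇒ NearFieldRechartLoss`** (NF of …FarRechartCoherence) — `C₁ := C₁`, `D := D`, `C₃ := 0`, `ε_N := min ε_M (1/C₁)`,
`A_N := 16λ⁴L + 4λ⁴L/(C₁ε₁)` with `L = 2¹⁴/(12δ⁹)`; cases: a defect within `2λ` (empty matching, kernel floor), sheltered to `λR_ε` (SM at `R_ε`, loss `0`),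
nearest defect at `m ∈ (2λ, λR_ε]` (SM at `m/(2λ)` by minimality of `m`, packing tail, kernel floor `m⁻⁴`, `m² ≤ λ²/(C₁ε₁)`). [this file] -/
theorem nearFieldRechartLoss_of_shelteredMatching {θ θ₀ : ℝ} (hS : ShelteredMatching θ θ₀) : NearFieldRechartLoss θ θ₀ := by
  intro hR C hC
  obtain ⟨lam, C₁, D, εM, hlam, hC₁, hD, hεM, hSM⟩ := hS hR C hC
  have hlam0 : 0 < lam := by linarith
  refine ⟨C₁, D, 0, min εM (1 / C₁), hC₁, hD, le_rfl, lt_min hεM (by positivity), fun ε₁ hε₁ hε₁le δ hδ hδ2 => ?_⟩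
  have hL0 : (0 : ℝ) ≤ 2 ^ 14 / (12 * δ ^ 9) := by positivity
  have hCε : 0 < C₁ * ε₁ := mul_pos hC₁ hε₁
  have hCε1 : C₁ * ε₁ ≤ 1 := by
    have h := hε₁le.trans (min_le_right _ _)
    rw [le_div_iff₀ hC₁] at h
    linarith
  refine ⟨16 * lam ^ 4 * (2 ^ 14 / (12 * δ ^ 9)) + 4 * lam ^ 4 * (2 ^ 14 / (12 * δ ^ 9)) / (C₁ * ε₁), by positivity,
    fun N y hy i hi c hc hca => ?_⟩
  have hiG : i ∈ goodSet 12 ε₁ θ δ y := farSet_subset_goodSet θ₀ 12 ε₁ θ δ y (Finset.mem_sdiff.mp hi).1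
  have hnn : 0 < nearestDist y i := lt_of_lt_of_le hδ (inWindow_of_mem_goodSet hiG).1
  have hK : 0 ≤ defectKernel 12 ε₁ θ δ y i := defectKernel_nonneg 12 ε₁ θ δ y i
  have hSM' := hSM ε₁ hε₁ (hε₁le.trans (min_le_left _ _)) δ hδ hδ2 N y hy i hi c hc hca
  rw [zero_mul, zero_add]
  -- the drift radius `R_ε = (C₁ε₁)^{-1/2}`
  obtain ⟨Rε, hRεpos, hRε2⟩ : ∃ Rε : ℝ, 0 < Rε ∧ Rε ^ 2 = 1 / (C₁ * ε₁) :=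
    ⟨Real.sqrt (1 / (C₁ * ε₁)), Real.sqrt_pos.mpr (by positivity), Real.sq_sqrt (by positivity)⟩
  have hCRε : C₁ * ε₁ * Rε ^ 2 = 1 := by rw [hRε2, mul_one_div_cancel hCε.ne']
  have hRε1 : 1 ≤ Rε := by
    by_contra hlt
    have hlt' : Rε < 1 := not_le.mp hlt
    have hsq : Rε ^ 2 < 1 := by nlinarith
    have h1 : (1 : ℝ) ≤ 1 / (C₁ * ε₁) := by rw [le_div_iff₀ hCε]; linarith
    linarith
  by_cases hA : ∃ k : Fin N, k ∉ goodSet 12 ε₁ θ δ y ∧ dist (y k) (y i) ≤ 2 * lam * nearestDist y i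
  · -- CASE 1 · a defect within `2λ·nn_i`: the empty matching; the whole near-field class is priced by the kernel floor
    obtain ⟨k, hkG, hkd⟩ := hA
    have hKf : 1 / (2 * lam) ^ 4 ≤ defectKernel 12 ε₁ θ δ y i :=
      inv_pow_le_defectKernel_of_near hiG hkG hδ (by positivity) hkd
    refine ⟨c, ∅, fun _ => 0, recharts_refl hca, Finset.empty_subset _, matched_empty D ε₁ y i c _, ?_⟩
    have hsub : ((goodSet 12 ε₁ θ δ y \ ∅).filter fun k =>
        C₁ * ε₁ * (dist (y i) (y k) / nearestDist y i) ^ 2 < 1) ⊆ goodSet 12 ε₁ θ δ y :=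
      (Finset.filter_subset _ _).trans Finset.sdiff_subset
    exact (neg_smoothTail_le_window hδ hδ2 hy hiG hsub).trans (loss_le_of_kernelFloor_near hL0 hlam0 hCε hKf)
  · have hA' : ∀ k : Fin N, k ∉ goodSet 12 ε₁ θ δ y → 2 * lam * nearestDist y i < dist (y k) (y i) := by
      intro k hk
      by_contra hle
      exact hA ⟨k, hk, not_lt.mp hle⟩
    by_cases hB : Sheltered (lam * Rε) 12 ε₁ θ δ y i
    · -- CASE 2 · sheltered out to the drift radius: SM at `R_ε` covers the whole near field, loss `0`
      obtain ⟨c', M, π, hcc', hMG, hM, hcov⟩ := hSM' Rε hRε1 hCRε.le hB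
      refine ⟨c', M, π, hcc', hMG, hM, ?_⟩
      have hSe : ((goodSet 12 ε₁ θ δ y \ M).filter fun k =>
          C₁ * ε₁ * (dist (y i) (y k) / nearestDist y i) ^ 2 < 1) = ∅ := by
        refine Finset.eq_empty_of_forall_notMem fun k hk => ?_
        rw [Finset.mem_filter, Finset.mem_sdiff] at hk
        obtain ⟨⟨hkG, hkM⟩, hlt⟩ := hk
        have hsq : (dist (y i) (y k) / nearestDist y i) ^ 2 < Rε ^ 2 := by
          rw [hRε2]
          by_contra hcon
          have hge := mul_le_mul_of_nonneg_left (not_lt.mp hcon) hCε.le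
          rw [mul_one_div_cancel hCε.ne'] at hge
          linarith
        have hlt' : dist (y i) (y k) / nearestDist y i < Rε := (abs_lt_of_sq_lt_sq' hsq hRεpos.le).2
        exact hkM (hcov k hkG (by rw [dist_comm]; exact ((div_lt_iff₀ hnn).mp hlt').le))
      rw [hSe]
      simp only [smoothTail, Finset.sum_empty, mul_zero, neg_zero]
      positivity
    · -- CASE 3 · the nearest defect at `m ∈ (2λ, λR_ε]`: SM at `R := m/(2λ)`, sheltered at `λR = m/2` by minimality of `m`
      have hB' : ∃ k : Fin N, dist (y k) (y i) ≤ lam * Rε * nearestDist y i ∧ k ∉ goodSet 12 ε₁ θ δ y := by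
        by_contra hno
        refine hB fun k hk => ?_
        by_contra hkG
        exact hno ⟨k, hk, hkG⟩
      obtain ⟨k₀, hk₀d, hk₀G⟩ := hB'
      have hne : ((goodSet 12 ε₁ θ δ y)ᶜ).Nonempty := ⟨k₀, Finset.mem_compl.mpr hk₀G⟩
      obtain ⟨k, hkc, hkmin⟩ := Finset.exists_min_image (goodSet 12 ε₁ θ δ y)ᶜ (fun k => dist (y k) (y i)) hne
      have hkG : k ∉ goodSet 12 ε₁ θ δ y := Finset.mem_compl.mp hkc
      have hdle : dist (y k) (y i) ≤ lam * Rε * nearestDist y i := (hkmin k₀ (Finset.mem_compl.mpr hk₀G)).trans hk₀d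
      have hdgt : 2 * lam * nearestDist y i < dist (y k) (y i) := hA' k hkG
      have hdpos : 0 < dist (y k) (y i) := lt_of_le_of_lt (by positivity) hdgt
      -- the clear radius `m = |y k − y i| / nn_i ∈ (2λ, λR_ε]` and the matching radius `R := m/(2λ) ∈ [1, R_ε/2]`
      set m : ℝ := dist (y k) (y i) / nearestDist y i with hm
      have hmnn : m * nearestDist y i = dist (y k) (y i) := by rw [hm]; exact div_mul_cancel₀ _ hnn.ne'
      have hmgt : 2 * lam < m := by rw [hm, lt_div_iff₀ hnn]; exact hdgt
      have hmpos : 0 < m := by linarith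
      have hmle : m ≤ lam * Rε := by rw [hm, div_le_iff₀ hnn]; exact hdle
      have hR1 : 1 ≤ m / (2 * lam) := by rw [le_div_iff₀ (by positivity)]; linarith
      have hRle : m / (2 * lam) ≤ Rε / 2 := by
        rw [div_le_iff₀ (by positivity)]
        calc m ≤ lam * Rε := hmle
          _ = Rε / 2 * (2 * lam) := by ring
      have hCR : C₁ * ε₁ * (m / (2 * lam)) ^ 2 ≤ 1 := by
        have hR2 : (m / (2 * lam)) ^ 2 ≤ (Rε / 2) ^ 2 := pow_le_pow_left₀ (by positivity) hRle 2
        calc C₁ * ε₁ * (m / (2 * lam)) ^ 2 ≤ C₁ * ε₁ * (Rε / 2) ^ 2 := mul_le_mul_of_nonneg_left hR2 hCε.le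
          _ = C₁ * ε₁ * Rε ^ 2 / 4 := by ring
          _ ≤ 1 := by rw [hCRε]; norm_num
      have hlamR : lam * (m / (2 * lam)) * nearestDist y i = dist (y k) (y i) / 2 := by
        rw [← hmnn]; field_simp
      have hshel : Sheltered (lam * (m / (2 * lam))) 12 ε₁ θ δ y i := by
        intro k' hk'
        by_contra hk'G
        have h1 : dist (y k) (y i) ≤ dist (y k') (y i) := hkmin k' (Finset.mem_compl.mpr hk'G)
        rw [hlamR] at hk'
        linarith
      obtain ⟨c', M, π, hcc', hMG, hM, hcov⟩ := hSM' (m / (2 * lam)) hR1 hCR hshel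
      refine ⟨c', M, π, hcc', hMG, hM, ?_⟩
      have hSG : ((goodSet 12 ε₁ θ δ y \ M).filter fun k =>
          C₁ * ε₁ * (dist (y i) (y k) / nearestDist y i) ^ 2 < 1) ⊆ goodSet 12 ε₁ θ δ y :=
        (Finset.filter_subset _ _).trans Finset.sdiff_subset
      have hSfar : ∀ k' ∈ ((goodSet 12 ε₁ θ δ y \ M).filter fun k =>
          C₁ * ε₁ * (dist (y i) (y k) / nearestDist y i) ^ 2 < 1),
          m / (2 * lam) * nearestDist y i ≤ dist (y i) (y k') := by
        intro k' hk'
        rw [Finset.mem_filter, Finset.mem_sdiff] at hk'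
        obtain ⟨⟨hk'G, hk'M⟩, -⟩ := hk'
        by_contra hcon
        exact hk'M (hcov k' hk'G (by rw [dist_comm]; exact (not_le.mp hcon).le))
      have hTP := neg_smoothTail_le_of_radius hδ hδ2 hy hiG hSG hR1 hSfar
      have hKf : 1 / m ^ 4 ≤ defectKernel 12 ε₁ θ δ y i :=
        inv_pow_le_defectKernel_of_near hiG hkG hδ hmpos hmnn.symm.le
      have hm2 : m ^ 2 ≤ lam ^ 2 * (1 / (C₁ * ε₁)) := by
        rw [← hRε2, ← mul_pow]
        exact pow_le_pow_left₀ hmpos.le hmle 2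
      exact hTP.trans (loss_le_of_kernelFloor_clear hL0 hlam0 hCε hmpos hKf hm2)

/-! ## §4  The nodes: Z3k ⟸ FF ∧ SM; slot Z from seven leaves -/

/-- ★ **THE NODE: `FarFieldShadowBound ∧ ShelteredMatching ⇒ SitewiseRechartLoss`** (Z3k by name; LAYER 1 of …FarRechartCoherence + §3). [this file] -/
theorem sitewiseRechartLoss_of_far_sheltered {θ θ₀ : ℝ} (hF : FarFieldShadowBound θ θ₀) (hS : ShelteredMatching θ θ₀) :
    SitewiseRechartLoss θ θ₀ :=
  sitewiseRechartLoss_of_far_near hF (nearFieldRechartLoss_of_shelteredMatching hS)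

/-- The node at the parameters of record `(θ, θ₀) = (1/25, 1/2000)`. [this file] -/
theorem sitewiseRechartLoss_record_of_far_sheltered (hF : FarFieldShadowBound (1 / 25) (1 / 2000))
    (hS : ShelteredMatching (1 / 25) (1 / 2000)) : SitewiseRechartLoss (1 / 25) (1 / 2000) :=
  sitewiseRechartLoss_of_far_sheltered hF hS

/-- ★ **SLOT Z FROM SEVEN LEAVES:
`FarCoreExcess ∧ ShelteredFarCharting ∧ NormalCorePricing ∧ TailDriftBound ∧ FarFieldShadowBound ∧ ShelteredMatching ∧ ScaleBadFloor ⇒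
FarAggregatePricing 12 (1/25) (1/2000) (1/(2·10⁷))`** — the landed record `farAggregatePricing_record_of_six_leaves_sitewise` with Z3k from §4. [this file] -/
theorem farAggregatePricing_record_of_leaves_sheltered
    (h2 : FarCoreExcess (1 / 25) (1 / 2000) (1 / (2 * 10 ^ 7)))
    (hra : ShelteredFarCharting (1 / 25) (1 / 2000)) (hrb : NormalCorePricing (1 / 25))
    (h3a : TailDriftBound (1 / 25) (1 / 2000)) (hF : FarFieldShadowBound (1 / 25) (1 / 2000))
    (hS : ShelteredMatching (1 / 25) (1 / 2000)) (h4 : ScaleBadFloor (1 / 25) (1 / (2 * 10 ^ 7))) :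
    FarAggregatePricing 12 (1 / 25) (1 / 2000) (1 / (2 * 10 ^ 7)) :=
  farAggregatePricing_record_of_six_leaves_sitewise h2 hra hrb h3a (sitewiseRechartLoss_record_of_far_sheltered hF hS) h4

/-! ## §5  Appendix: the rigidity leaf dominates the g50 incidence leaf — SM ⇒ DL ⇒ IC (PROVED) -/

/-- **DL · `DefectLocality θ θ₀`** (the qualitative content of IC; an ASSEMBLY POINT here, proved from SM below — not a leaf): R_aff ⇒
`∀ C ≥ 0 ∃ λ ≥ 1, C₁ > 0, ε_L > 0 ∀ ε₁ ≤ ε_L ∀ δ`: coarse INCOHERENCE of the class of an admissible `Cε₁`-exact chart at `2r` below the drift radius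
(`1 ≤ r`, `C₁ε₁r² ≤ 1`) forces a NON-GOOD site within `λr·nn_i`. -/
def DefectLocality (θ θ₀ : ℝ) : Prop :=
  AffineChartStraightening → ∀ C : ℝ, 0 ≤ C → ∃ lam C₁ εL : ℝ, 1 ≤ lam ∧ 0 < C₁ ∧ 0 < εL ∧
    ∀ ε₁ : ℝ, 0 < ε₁ → ε₁ ≤ εL → ∀ δ : ℝ, 0 < δ → δ ≤ 2 →
      ∀ (N : ℕ) (y : Fin N → EuclideanSpace ℝ (Fin 3)), Function.Injective y →
        ∀ i ∈ farSet θ₀ 12 ε₁ θ δ y \ goodScaleBadSet 12 ε₁ θ δ y, ∀ c : Chart, IsChart C ε₁ y i c → ChartAdmissible θ c →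
          ∀ r : ℝ, 1 ≤ r → C₁ * ε₁ * r ^ 2 ≤ 1 → ¬ CoarseCoherent θ ε₁ δ y i c (2 * r) →
            ∃ k : Fin N, k ∉ goodSet 12 ε₁ θ δ y ∧ dist (y k) (y i) ≤ lam * r * nearestDist y i

/-- ★ **`ShelteredMatching ⇒ DefectLocality`** — `λ' := 2λ`, `C₁' := 4C₁`: were the `2λr`-ball defect-free, SM at `R := 2r` (`C₁ε₁(2r)² = 4C₁ε₁r² ≤ 1`)
would match the whole good `2r`-ball by a rechart, i.e. `CoarseCoherent (2r)` (`coarseCoherent_of_matched`). [this file] -/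
theorem defectLocality_of_shelteredMatching {θ θ₀ : ℝ} (hS : ShelteredMatching θ θ₀) : DefectLocality θ θ₀ := by
  intro hR C hC
  obtain ⟨lam, C₁, D, εM, hlam, hC₁, hD, hεM, hSM⟩ := hS hR C hC
  refine ⟨2 * lam, 4 * C₁, εM, by linarith, by positivity, hεM, fun ε₁ hε₁ hε₁le δ hδ hδ2 N y hy i hi c hc hca r hr hcap hinc => ?_⟩
  by_contra hno
  have hshel : Sheltered (lam * (2 * r)) 12 ε₁ θ δ y i := by
    intro k hk
    by_contra hkG
    refine hno ⟨k, hkG, ?_⟩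
    calc dist (y k) (y i) ≤ lam * (2 * r) * nearestDist y i := hk
      _ = 2 * lam * r * nearestDist y i := by ring
  have h2r : (1 : ℝ) ≤ 2 * r := by linarith
  have hcap' : C₁ * ε₁ * (2 * r) ^ 2 ≤ 1 := by nlinarith
  obtain ⟨c', M, π, hcc', -, hM, hcov⟩ := hSM ε₁ hε₁ hε₁le δ hδ hδ2 N y hy i hi c hc hca (2 * r) h2r hcap' hshel
  exact hinc (coarseCoherent_of_matched hcc' hM hcov)

/-- ★ **`DefectLocality ⇒ IncoherenceCost`** (IC of …FarRechartCoherence, as typed: `κ` after `ε₁`) — `κ := C₁ε₁/λ⁴`: the defect DL puts within `λr·nn_i`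
gives `K ≥ (λr)⁻⁴` and `r ≤ r² ≤ 1/(C₁ε₁)`.  (So the dependent-κ IC never needed more than one nearby defect; the UNIFORM-κ reading is false — header.)
[this file] -/
theorem incoherenceCost_of_defectLocality {θ θ₀ : ℝ} (hL : DefectLocality θ θ₀) : IncoherenceCost θ θ₀ := by
  intro hR C hC
  obtain ⟨lam, C₁, εL, hlam, hC₁, hεL, hDL⟩ := hL hR C hC
  have hlam0 : 0 < lam := by linarith
  refine ⟨C₁, εL, hC₁, hεL, fun ε₁ hε₁ hε₁le δ hδ hδ2 => ⟨C₁ * ε₁ / lam ^ 4, by positivity, ?_⟩⟩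
  intro N y hy i hi c hc hca r hr hcap hinc
  obtain ⟨k, hkG, hkd⟩ := hDL ε₁ hε₁ hε₁le δ hδ hδ2 N y hy i hi c hc hca r hr hcap hinc
  have hiG : i ∈ goodSet 12 ε₁ θ δ y := farSet_subset_goodSet θ₀ 12 ε₁ θ δ y (Finset.mem_sdiff.mp hi).1
  have hKf : 1 / (lam * r) ^ 4 ≤ defectKernel 12 ε₁ θ δ y i :=
    inv_pow_le_defectKernel_of_near hiG hkG hδ (by positivity) hkd
  exact kappa_le_of_kernelFloor hr hlam0 (mul_pos hC₁ hε₁) hcap hKf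

/-- **`ShelteredMatching ⇒ IncoherenceCost`** (composition). [this file] -/
theorem incoherenceCost_of_shelteredMatching {θ θ₀ : ℝ} (hS : ShelteredMatching θ θ₀) : IncoherenceCost θ θ₀ :=
  incoherenceCost_of_defectLocality (defectLocality_of_shelteredMatching hS)

/-- The g50 coherence-radius assembly fed by the rigidity leaf: `ShortRangeCoherence ∧ ShelteredMatching ⇒ NearFieldRechartLoss`. [this file] -/
theorem nearFieldRechartLoss_of_coherence_sheltered {θ θ₀ : ℝ} (hC : ShortRangeCoherence θ θ₀) (hS : ShelteredMatching θ θ₀) :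
    NearFieldRechartLoss θ θ₀ :=
  nearFieldRechartLoss_of_coherence_cost hC (incoherenceCost_of_shelteredMatching hS)

end Summit.AtomisticToContinuum.Crystallization.Theorems.OverbindingBudgetAffineFarSmoothSplit
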